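import Literature.NumberTheory.GaloisRepresentations.LubinTateColemanRelativeCoatesWilesTwo
import Literature.NumberTheory.GaloisRepresentations.LubinTateColemanRelativeContinuousTwo
import HarnessLib

/-!
# The MOMENTS of the Coleman coordinates at `q = 2`: `mom_k(r) := [X⁰] D_E^k ((1 + u⁻¹X)·(r ∘ f))` — continuous `𝒪_E`-linear
# functionals on the coordinate module with `mom_k(r_β) = [X⁰] D_E^k ((δ_E g_β)~)` (= the Coates–Wiles value of the measure lane's
# socket) and `mom_k(r_{σ̃β}) = χ_π(σ̃)^{k+1} · mom_k(r_β)` — the Coleman-lane half of the junction (J-i) with de Shalit's `i`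

De Shalit, *Iwasawa theory of elliptic curves with complex multiplication* (1987), Ch. I §3.4 (10)–§3.5 (11) ("`∫_G (1+S)^{κ(σ)} dμ_β =
log̃ g_β ∘ θ(S)`", "`∫_G κ(σ)^k dμ_β(σ) = D^k log g_β (0)` … the k-th Coates–Wiles homomorphism"), II §4.7 (15)–(17).  The Coleman lane of the
tree encodes a norm-coherent unit `β ∈ 𝒰(E·K_π^∞)` by its COORDINATE `r_β ∈ 𝒪_E⟦Y⟧` with `(δ_E g_β)~ = (1 + u⁻¹X)·(r_β ∘ f)`
(`relUnitCoordTwo`, `relTildeSeries_eq_relUnitCoordTwo`); the measure lane (`PAdicOneVariableSeriesFamilyOfRelNormCoherentUnits`,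
`LubinTateColemanRelativeCoatesWilesTwo`) reads the SAME series `(δ_E g_β)~` through the comparison `ϑ` and records its moments
`[X⁰] D_E^k ((δ_E g_β)~) = c − u·π^k·φ(c)`, `c = φ^{CW,E}_{k+1}(β)`.  THIS file puts the moment functionals on the COORDINATE side (0 sorry):

* `coordMoment k r := [X⁰] D_E^[k] ((1 + u⁻¹X)·(r ∘ f))` — additive, `𝒪_E`-homogeneous (`coordMoment_add/zero/C_mul`), ★ continuous
  (`continuous_coordMoment`, coefficientwise topology; tools of `PowerSeriesTopNilpotentContinuous`);
* ★★ `coordMoment_relUnitCoordTwo` — **`mom_k(r_β) = [X⁰] D_E^[k] ((δ_E g_β)~)`**, and with the measure lane's (17):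
  ★★ `coordMoment_relUnitCoordTwo_eq_coatesWiles` — **`mom_k(r_β) = c − u·π^k·φ(c)`, `c = [X⁰] D_E^[k](δ_E g_β)` the relative Coates–Wiles value**;
* ★★ `coordMoment_relUnitCoordTwo_galAct` — **`mom_k(r_{σ̃β}) = χ_π(σ̃)^{k+1} · mom_k(r_β)`** for `σ̃ ∈ Γ_F` fixing `E` (de Shalit I §3.5 (ii)):
  on the image of `𝒰` the functional `mom_k` is EQUIVARIANT for the character `v ↦ v^{k+1}` of the unit twists — the normalisation by which
  a `Λ(𝒪_F^×)`-linear comparison `M → Λ(𝒢, 𝐃)` between the two lanes is pinned (memo BRICK-C-TOPOLOGY-g12 §4).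

## References
* E. de Shalit, *Iwasawa theory of elliptic curves with complex multiplication* (1987), Ch. I §3.4 (10), §3.5 (11) and (i)–(ii); II §4.7 (15)–(17).
  [deShalit1987]
* J. Coates, A. Wiles, *On the conjecture of Birch and Swinnerton-Dyer*, Invent. Math. 39 (1977), §2 (the homomorphisms `φ_k`). [CoatesWiles1977]
-/

noncomputable section

open PowerSeries
open scoped PowerSeries.WithPiTopology

namespace Literature.NumberTheory.GaloisRepresentations

section CoordMomentsTwo

open GaloisRepresentations.IsNonarchimedeanLocalField LubinTate ValuativeRel Field

variable {F : Type} [Field F] [ValuativeRel F] [TopologicalSpace F] [IsNonarchimedeanLocalField F]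

attribute [local instance] ltNormUniformSpace ltNormIsUniformAddGroup rk1 nF nE fintypeResidueField

variable {π : 𝒪[F]} (hπ : (valuation F).IsUniformizer (π : F))
variable (E : IntermediateField F (AlgebraicClosure F)) [FiniteDimensional F E] [Normal F E] [IsGalois F E]
variable (hq : residueFieldCard F = 2) (hE : E ≤ maxUnramified F) {σ₀ : absoluteGaloisGroup F} (hσ₀ : IsAbsArithFrob σ₀)
variable (u : (LTCoeff F)ˣ) (hu : LTCoeff.of F π = residueFieldCard F * u)

/-! ### §1. The moment functionals on the coordinate module -/

/-- **`Φ(r) := (1 + u⁻¹X)·(r ∘ f)`** — the trace-zero series with coordinate `r` (`ker 𝒮_E = (1+u⁻¹X)·𝒪_E⟦f⟧`; the uniformiser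
hypothesis `hπ` is carried for uniformity of the interface). [cite: deShalit1987, Ch. I §3.7] -/
@[nolint unusedArguments]
def coordToKer (_hπ : (valuation F).IsUniformizer (π : F)) (E : IntermediateField F (AlgebraicClosure F)) [FiniteDimensional F E]
    (u : (LTCoeff F)ˣ) (r : PowerSeries (unitBall E)) : PowerSeries (unitBall E) :=
  (1 + PowerSeries.C (algebraMap (LTCoeff F) (unitBall E) (↑u⁻¹ : LTCoeff F)) * PowerSeries.X) *
    PowerSeries.subst ((ltSer F π).map (algebraMap (LTCoeff F) (unitBall E))) r

omit [Normal F E] [IsGalois F E] in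
/-- `Φ` is additive. [cite: deShalit1987, Ch. I §3.7] -/
theorem coordToKer_add (r r' : PowerSeries (unitBall E)) :
    coordToKer hπ E u (r + r') = coordToKer hπ E u r + coordToKer hπ E u r' := by
  have hs : PowerSeries.HasSubst ((ltSer F π).map (algebraMap (LTCoeff F) (unitBall E))) :=
    PowerSeries.HasSubst.of_constantCoeff_zero' ((isLTSeries_ltSer π).map _).constantCoeff_eq_zero
  rw [coordToKer, coordToKer, coordToKer, ← PowerSeries.coe_substAlgHom hs, map_add, mul_add]

omit [Normal F E] [IsGalois F E] in
/-- `Φ(C c · r) = C c · Φ(r)`. [cite: deShalit1987, Ch. I §3.7] -/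
theorem coordToKer_C_mul (c : unitBall E) (r : PowerSeries (unitBall E)) :
    coordToKer hπ E u (PowerSeries.C c * r) = PowerSeries.C c * coordToKer hπ E u r := by
  have hs : PowerSeries.HasSubst ((ltSer F π).map (algebraMap (LTCoeff F) (unitBall E))) :=
    PowerSeries.HasSubst.of_constantCoeff_zero' ((isLTSeries_ltSer π).map _).constantCoeff_eq_zero
  rw [coordToKer, coordToKer, ← PowerSeries.coe_substAlgHom hs, ← PowerSeries.smul_eq_C_mul r c, map_smul, PowerSeries.smul_eq_C_mul]
  ring

omit [Normal F E] [IsGalois F E] in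
/-- `Φ` is continuous (coefficientwise topology). [cite: deShalit1987, Ch. I §3.7] -/
theorem continuous_coordToKer : Continuous (coordToKer hπ E u) :=
  continuous_one_add_mul_subst E u

/-- **`mom_k(r) := [X⁰] D_E^[k] (Φ r)`**, `D_E = ω_f^E·d/dX` the relative invariant derivation — the `k`-th MOMENT of the coordinate `r`
(de Shalit's `D^k(·)(0)`, I §3.5 (11)). [cite: deShalit1987, Ch. I §3.5 (11); Ch. II §4.7 (15)] -/
def coordMoment (k : ℕ) (r : PowerSeries (unitBall E)) : unitBall E :=
  PowerSeries.constantCoeff ((fun g : PowerSeries (unitBall E) =>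
    (invDiff (isLTRing_LTCoeff hπ) (isLTSeries_LTCoeff π)).map (algebraMap (LTCoeff F) (unitBall E)) * d⁄dX (unitBall E) g)^[k]
      (coordToKer hπ E u r))

omit [Normal F E] [IsGalois F E] in
/-- `D_E^[k]` is additive. [cite: deShalit1987, Ch. I §3.5] -/
theorem iterate_relDerivation_add (k : ℕ) (G H : PowerSeries (unitBall E)) :
    (fun g : PowerSeries (unitBall E) =>
        (invDiff (isLTRing_LTCoeff hπ) (isLTSeries_LTCoeff π)).map (algebraMap (LTCoeff F) (unitBall E)) * d⁄dX (unitBall E) g)^[k] (G + H) =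
      (fun g : PowerSeries (unitBall E) =>
          (invDiff (isLTRing_LTCoeff hπ) (isLTSeries_LTCoeff π)).map (algebraMap (LTCoeff F) (unitBall E)) * d⁄dX (unitBall E) g)^[k] G +
        (fun g : PowerSeries (unitBall E) =>
          (invDiff (isLTRing_LTCoeff hπ) (isLTSeries_LTCoeff π)).map (algebraMap (LTCoeff F) (unitBall E)) * d⁄dX (unitBall E) g)^[k] H := by
  induction k generalizing G H with
  | zero => rfl
  | succ k ih => rw [Function.iterate_succ_apply, Function.iterate_succ_apply, Function.iterate_succ_apply, map_add, mul_add, ih]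

omit [Normal F E] [IsGalois F E] in
/-- `mom_k` is additive. [cite: deShalit1987, Ch. I §3.5 (i)] -/
theorem coordMoment_add (k : ℕ) (r r' : PowerSeries (unitBall E)) :
    coordMoment hπ E u k (r + r') = coordMoment hπ E u k r + coordMoment hπ E u k r' := by
  unfold coordMoment
  rw [coordToKer_add hπ E u, iterate_relDerivation_add hπ E, map_add]

omit [Normal F E] [IsGalois F E] in
/-- `mom_k(0) = 0`. [cite: deShalit1987, Ch. I §3.5 (i)] -/
theorem coordMoment_zero (k : ℕ) : coordMoment hπ E u k 0 = 0 := by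
  have h := coordMoment_add hπ E u k 0 0
  rw [add_zero] at h
  exact left_eq_add.mp h

omit [Normal F E] [IsGalois F E] in
/-- `mom_k(C c · r) = c · mom_k(r)` (`𝒪_E`-homogeneity). [cite: deShalit1987, Ch. I §3.5] -/
theorem coordMoment_C_mul (k : ℕ) (c : unitBall E) (r : PowerSeries (unitBall E)) :
    coordMoment hπ E u k (PowerSeries.C c * r) = c * coordMoment hπ E u k r := by
  unfold coordMoment
  rw [coordToKer_C_mul hπ E u, iterate_derivation_C_mul, map_mul, PowerSeries.constantCoeff_C]

omit [Normal F E] [IsGalois F E] in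
/-- `D_E^[k]` is continuous (coefficientwise topology). [cite: BourbakiGT1, Ch. I §4.1 Prop. 1] -/
theorem continuous_iterate_relDerivation (k : ℕ) :
    Continuous ((fun g : PowerSeries (unitBall E) =>
      (invDiff (isLTRing_LTCoeff hπ) (isLTSeries_LTCoeff π)).map (algebraMap (LTCoeff F) (unitBall E)) * d⁄dX (unitBall E) g)^[k]) := by
  induction k with
  | zero => exact continuous_id
  | succ k ih =>
    rw [Function.iterate_succ']
    exact (continuous_const.mul (PowerSeries.WithPiTopology.continuous_derivative (R := unitBall E))).comp ih

omit [Normal F E] [IsGalois F E] in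
/-- ★ **`mom_k` is continuous** on `𝒪_E⟦Y⟧` (coefficientwise topology). [cite: deShalit1987, Ch. I §3.5] [cite: BourbakiGT1, Ch. I §4.1 Prop. 1] -/
theorem continuous_coordMoment (k : ℕ) : Continuous (coordMoment hπ E u k) :=
  (PowerSeries.WithPiTopology.continuous_constantCoeff (unitBall E)).comp
    ((continuous_iterate_relDerivation hπ E k).comp (continuous_coordToKer hπ E u))

/-! ### §2. On the coordinates of the units: the moments of `(δ_E g_β)~` -/

include hu in
/-- ★★ **`mom_k(r_β) = [X⁰] D_E^[k] ((δ_E g_β)~)`** — on the Coleman coordinate of a norm-coherent unit the moment functional returns the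
`k`-th moment of de Shalit's log-free series (`(δβ)~ = (1 + u⁻¹X)·(r_β ∘ f)`). [cite: deShalit1987, Ch. I §3.4 (10), §3.5 (11)] -/
theorem coordMoment_relUnitCoordTwo (k : ℕ) (β : RelNormCoherentUnits hπ E) :
    coordMoment hπ E u k (relUnitCoordTwo hπ E hq hE hσ₀ u hu β) =
      PowerSeries.constantCoeff ((fun g : PowerSeries (unitBall E) =>
        (invDiff (isLTRing_LTCoeff hπ) (isLTSeries_LTCoeff π)).map (algebraMap (LTCoeff F) (unitBall E)) * d⁄dX (unitBall E) g)^[k]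
          (relTildeSeries hπ E hq hE hσ₀ (u : LTCoeff F) β)) := by
  rw [coordMoment, coordToKer, ← relTildeSeries_eq_relUnitCoordTwo hπ E hq hE hσ₀ u hu β]

include hu in
/-- ★★ **`mom_k(r_β) = c − u·π^k·φ(c)`, `c = [X⁰] D_E^[k] (δ_E g_β)` the relative COATES–WILES value** (de Shalit II (17); the measure lane's
`constantCoeff_iterate_relDerivation_relTildeSeries`): the moments of the coordinate of `β` are the Euler-twisted Coates–Wiles values of `β`.
[cite: deShalit1987, Ch. I §3.5 (11); Ch. II §4.7 (17)] [cite: CoatesWiles1977, §2] -/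
theorem coordMoment_relUnitCoordTwo_eq_coatesWiles (k : ℕ) (β : RelNormCoherentUnits hπ E) :
    coordMoment hπ E u k (relUnitCoordTwo hπ E hq hE hσ₀ u hu β) =
      PowerSeries.constantCoeff ((fun g : PowerSeries (unitBall E) =>
          (invDiff (isLTRing_LTCoeff hπ) (isLTSeries_LTCoeff π)).map (algebraMap (LTCoeff F) (unitBall E)) *
            d⁄dX (unitBall E) g)^[k] (relLogDerivSeries hπ E hq hE hσ₀ β)) -
        algebraMap (LTCoeff F) (unitBall E) (u : LTCoeff F) * algebraMap (LTCoeff F) (unitBall E) (LTCoeff.of F π) ^ k *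
          (frobUnitBall E σ₀ : unitBall E →+* unitBall E)
            (PowerSeries.constantCoeff ((fun g : PowerSeries (unitBall E) =>
              (invDiff (isLTRing_LTCoeff hπ) (isLTSeries_LTCoeff π)).map (algebraMap (LTCoeff F) (unitBall E)) *
                d⁄dX (unitBall E) g)^[k] (relLogDerivSeries hπ E hq hE hσ₀ β))) := by
  rw [coordMoment_relUnitCoordTwo hπ E hq hE hσ₀ u hu, constantCoeff_iterate_relDerivation_relTildeSeries]

include hu in
/-- ★★ **`mom_k(r_{σ̃β}) = χ_π(σ̃)^{k+1} · mom_k(r_β)` for `σ̃ ∈ Γ_F` fixing `E`** (de Shalit I §3.5 (ii) `φ_k(γβ) = κ(γ)^k φ_k(β)`, here for the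
`x·μ`-normalised moments): on the coordinates of the units, `mom_k` transforms under the unit twists by the character `v ↦ v^{k+1}`.
[cite: deShalit1987, Ch. I §3.4 Lemma (ii), §3.5 (ii)] -/
theorem coordMoment_relUnitCoordTwo_galAct (k : ℕ) (β : RelNormCoherentUnits hπ E) {σ : absoluteGaloisGroup F}
    (hσE : ∀ x : E, σ • (x : AlgebraicClosure F) = x) :
    coordMoment hπ E u k (relUnitCoordTwo hπ E hq hE hσ₀ u hu (β.galAct σ)) =
      algebraMap 𝒪[F] (unitBall E) (lubinTateChar hπ σ : 𝒪[F]) ^ (k + 1) * coordMoment hπ E u k (relUnitCoordTwo hπ E hq hE hσ₀ u hu β) := by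
  rw [coordMoment_relUnitCoordTwo hπ E hq hE hσ₀ u hu, coordMoment_relUnitCoordTwo hπ E hq hE hσ₀ u hu,
    constantCoeff_iterate_relDerivation_relTildeSeries_galAct hπ E hq hE hσ₀ (u : LTCoeff F) k β hσE]

include hu in
/-- `mom_k(r_{ββ'}) = mom_k(r_β) + mom_k(r_{β'})` (additivity on the units, `r_{ββ'} = r_β + r_{β'}`). [cite: deShalit1987, Ch. I §3.5 (i)] -/
theorem coordMoment_relUnitCoordTwo_mul (k : ℕ) (β β' : RelNormCoherentUnits hπ E) :
    coordMoment hπ E u k (relUnitCoordTwo hπ E hq hE hσ₀ u hu (β.mul β')) =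
      coordMoment hπ E u k (relUnitCoordTwo hπ E hq hE hσ₀ u hu β) + coordMoment hπ E u k (relUnitCoordTwo hπ E hq hE hσ₀ u hu β') := by
  rw [relUnitCoordTwo_mul, coordMoment_add]

include hq hE hσ₀ hu in
/-- ★ **`β ↦ mom_k(r_β)` is continuous on `𝒰(E·K_π^∞)`** (continuity of the Coleman coordinate, `continuous_relUnitCoordTwo`). [cite: deShalit1987, Ch. I §3.4 Corollary, §3.5] -/
theorem continuous_coordMoment_relUnitCoordTwo (k : ℕ) :
    Continuous fun β : RelNormCoherentUnits hπ E => coordMoment hπ E u k (relUnitCoordTwo hπ E hq hE hσ₀ u hu β) :=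
  (continuous_coordMoment hπ E u k).comp (continuous_relUnitCoordTwo hπ E hq hE hσ₀ u hu)

end CoordMomentsTwo

end Literature.NumberTheory.GaloisRepresentations
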